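import Mathlib
import Summits.Ventures.PercRepro2.TypedBundleCutRoots
import Summits.Ventures.PercRepro2.CutRootsA3Theorem
import Summits.Ventures.PercRepro2.K5StarAll
import Summits.Ventures.PercRepro2.TypedUncrossed
import Summits.Ventures.PercRepro2.TypedCoincidenceOB
import Summits.Ventures.PercRepro2.TypedOBehindA3

/-!
# The tower of the domain of record in ONE module (blind cell PercRepro2, p3 g5, 2026-08-25;
the six deposited layers TypedBundleCutRootsA3 → TypedBundleCutRootsA3Star → TypedBundleMild →
TypedBundleDistinctOB → TypedBundleOBehind → TypedDomainUnfold of p3 g3 / g4, bodies unchanged,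
merged so that the tower costs ONE olean level instead of six — p2 g5's ask of 19:00Z)

Each layer subtracts one class from the domain of record by the same four lines: a structure with
one more conjunct, its `_all` form, and the crux from it by `by_cases` on the conjunct and the
class theorem.  The layers and their class theorems: `ResidualCoreNHatCTBRA` (no cut-roots-A3
class; `RootBridge.typedCount_nonneg_of_hasCutRootsA3`), `ResidualCoreNHatCTBRAS` (no one-star of
degree three; `typedCount_nonneg_of_oneStar` on the landed certificate bundle `K5.starCerts_holds`),
`ResidualCoreNHatCTBRASU` (not mild; `RootBridge.typedCount_nonneg_of_mild`),
`ResidualCoreNHatCTBRASUD` (`o ≠ b`; `RootBridge.typedCount_nonneg_of_o_eq_b`),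
`ResidualCoreNHatCTBRASUDO` (`o` not behind `a₃`; `RootBridge.typedCount_eq_zero_of_oBehindA3`),
and the flat form `ResidualCoreNHatCTBRASUDO_iff` / `FlatDomain_all` / `HCov_all_of_flat_all`.
**The sentence of record**: the crux `HCov_all` follows from (TRI) on the eleven flat conditions
(`HCov_all_of_flat_all`).  Own work; standard axioms.
-/

namespace Summit.Ventures.PercRepro2

open UnionCluster

namespace CovForm

namespace TypedRed

section CoreA3

variable {V : Type*} {E : Type*} [DecidableEq V] [Fintype E] [DecidableEq E]

/-- **The domain of record without the two cut-roots classes.** -/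
structure ResidualCoreNHatCTBRA (ends : E → Sym2 V) (o a₁ a₂ a₃ b : V) (F : Finset E) : Prop where
  coreNHatCTBR : ResidualCoreNHatCTBR ends o a₁ a₂ a₃ b F
  no_cutRootsA3 : ¬ RootBridge.HasCutRootsA3 ends o a₁ a₂ a₃ b F

end CoreA3

section ClosureA3

variable (R : Type*) [Field R] [LinearOrder R] [IsStrictOrderedRing R]

/-- **Row 2′TRI on `ResidualCoreNHatCTBRA`, over every finite graph.** -/
def ResidualCoreNHatCTBRA_all : Prop :=
  ∀ (V E : Type) [Fintype V] [DecidableEq V] [Fintype E] [DecidableEq E]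
    (ends : E → Sym2 V) (o a₁ a₂ a₃ b : V) (F : Finset E) (τ : E → ℕ),
    (∀ e ∈ F, τ e = 1 ∨ τ e = 2) → ResidualCoreNHatCTBRA ends o a₁ a₂ a₃ b F →
      0 ≤ typedCount F (fun _ => false) τ
        (K3 ends o a₁ a₂ a₃ b : Config E → Config E → Config E → R)

/-- **THE CRUX OF RECORD FROM (TRI) ON THE DOMAIN WITHOUT THE TWO CUT-ROOTS CLASSES** —
unconditional (on p3's two theorems). -/
theorem HCov_all_of_residualCoreNHatCTBRA_all (hc : ResidualCoreNHatCTBRA_all R) : HCov_all R := by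
  refine HCov_all_of_residualCoreNHatCTBR_all R ?_
  intro V E _ _ _ _ ends o a₁ a₂ a₃ b F τ hτ hcore
  by_cases hr : RootBridge.HasCutRootsA3 ends o a₁ a₂ a₃ b F
  · exact RootBridge.typedCount_nonneg_of_hasCutRootsA3 ends o a₁ a₂ a₃ b F τ hτ hr
  · exact hc V E ends o a₁ a₂ a₃ b F τ hτ ⟨hcore, hr⟩

end ClosureA3

section CoreA3Star

variable {V : Type*} {E : Type*} [DecidableEq V] [Fintype E] [DecidableEq E]

/-- **The domain of record without the two cut-roots classes and without a one-star of degree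
three.** -/
structure ResidualCoreNHatCTBRAS (ends : E → Sym2 V) (o a₁ a₂ a₃ b : V) (F : Finset E) : Prop where
  coreNHatCTBRA : ResidualCoreNHatCTBRA ends o a₁ a₂ a₃ b F
  not_oneStar : ¬ OneStar ends o a₁ a₂ a₃ b F

end CoreA3Star

section ClosureA3Star

variable (R : Type*) [Field R] [LinearOrder R] [IsStrictOrderedRing R]

/-- **Row 2′TRI on `ResidualCoreNHatCTBRAS`, over every finite graph.** -/
def ResidualCoreNHatCTBRAS_all : Prop :=
  ∀ (V E : Type) [Fintype V] [DecidableEq V] [Fintype E] [DecidableEq E]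
    (ends : E → Sym2 V) (o a₁ a₂ a₃ b : V) (F : Finset E) (τ : E → ℕ),
    (∀ e ∈ F, τ e = 1 ∨ τ e = 2) → ResidualCoreNHatCTBRAS ends o a₁ a₂ a₃ b F →
      0 ≤ typedCount F (fun _ => false) τ
        (K3 ends o a₁ a₂ a₃ b : Config E → Config E → Config E → R)

/-- **THE CRUX OF RECORD FROM (TRI) ON THE DOMAIN WITHOUT THE TWO CUT-ROOTS CLASSES AND WITHOUT
ONE-STARS OF DEGREE THREE** — unconditional, on the landed certificate bundle and the two cut-roots
theorems. -/
theorem HCov_all_of_residualCoreNHatCTBRAS_all (hc : ResidualCoreNHatCTBRAS_all R) : HCov_all R := by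
  refine HCov_all_of_residualCoreNHatCTBRA_all R ?_
  intro V E _ _ _ _ ends o a₁ a₂ a₃ b F τ hτ hcore
  have hred := hcore.coreNHatCTBR.coreNHatCTB.coreNHatC.coreNHat.core.residualConR.residualCon.residual.reduced
  by_cases hs : OneStar ends o a₁ a₂ a₃ b F
  · exact typedCount_nonneg_of_oneStar (K5.starCerts_holds R) ends o a₁ a₂ a₃ b F τ hτ
      hcore.coreNHatCTBR.coreNHatCTB.coreNHatC.coreNHat.core.marks hred.no_loop hred.no_parallel hs
  · exact hc V E ends o a₁ a₂ a₃ b F τ hτ ⟨hcore, hs⟩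

end ClosureA3Star

section CoreMild

variable {V : Type*} {E : Type*} [DecidableEq V] [Fintype E] [DecidableEq E]

/-- **The domain of record without the mild class** (the typed kernel's negative mass sits on
root-crossed copies only, so a mild instance is closed pointwise). -/
structure ResidualCoreNHatCTBRASU (ends : E → Sym2 V) (o a₁ a₂ a₃ b : V) (F : Finset E) : Prop where
  coreNHatCTBRAS : ResidualCoreNHatCTBRAS ends o a₁ a₂ a₃ b F
  not_mild : ¬ RootBridge.MildInst ends o a₁ a₂ a₃ b F (fun _ => false)

end CoreMild

section ClosureMild

variable (R : Type*) [Field R] [LinearOrder R] [IsStrictOrderedRing R]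

/-- **Row 2′TRI on `ResidualCoreNHatCTBRASU`, over every finite graph.** -/
def ResidualCoreNHatCTBRASU_all : Prop :=
  ∀ (V E : Type) [Fintype V] [DecidableEq V] [Fintype E] [DecidableEq E]
    (ends : E → Sym2 V) (o a₁ a₂ a₃ b : V) (F : Finset E) (τ : E → ℕ),
    (∀ e ∈ F, τ e = 1 ∨ τ e = 2) → ResidualCoreNHatCTBRASU ends o a₁ a₂ a₃ b F →
      0 ≤ typedCount F (fun _ => false) τ
        (K3 ends o a₁ a₂ a₃ b : Config E → Config E → Config E → R)

/-- **THE CRUX OF RECORD FROM (TRI) ON THE DOMAIN WITHOUT THE MILD CLASS** — unconditional (on the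
landed certificate bundle, the two cut-roots theorems and the mild theorem). -/
theorem HCov_all_of_residualCoreNHatCTBRASU_all (hc : ResidualCoreNHatCTBRASU_all R) :
    HCov_all R := by
  refine HCov_all_of_residualCoreNHatCTBRAS_all R ?_
  intro V E _ _ _ _ ends o a₁ a₂ a₃ b F τ hτ hcore
  by_cases hm : RootBridge.MildInst ends o a₁ a₂ a₃ b F (fun _ => false)
  · exact RootBridge.typedCount_nonneg_of_mild ends o a₁ a₂ a₃ b F (fun _ => false) τ hτ hm
  · exact hc V E ends o a₁ a₂ a₃ b F τ hτ ⟨hcore, hm⟩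

end ClosureMild

section CoreDistinctOB

variable {V : Type*} {E : Type*} [DecidableEq V] [Fintype E] [DecidableEq E]

/-- **The domain of record with `o ≠ b`.** -/
structure ResidualCoreNHatCTBRASUD (ends : E → Sym2 V) (o a₁ a₂ a₃ b : V) (F : Finset E) :
    Prop where
  coreNHatCTBRASU : ResidualCoreNHatCTBRASU ends o a₁ a₂ a₃ b F
  o_ne_b : o ≠ b

end CoreDistinctOB

section ClosureDistinctOB

variable (R : Type*) [Field R] [LinearOrder R] [IsStrictOrderedRing R]

/-- **Row 2′TRI on `ResidualCoreNHatCTBRASUD`, over every finite graph.** -/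
def ResidualCoreNHatCTBRASUD_all : Prop :=
  ∀ (V E : Type) [Fintype V] [DecidableEq V] [Fintype E] [DecidableEq E]
    (ends : E → Sym2 V) (o a₁ a₂ a₃ b : V) (F : Finset E) (τ : E → ℕ),
    (∀ e ∈ F, τ e = 1 ∨ τ e = 2) → ResidualCoreNHatCTBRASUD ends o a₁ a₂ a₃ b F →
      0 ≤ typedCount F (fun _ => false) τ
        (K3 ends o a₁ a₂ a₃ b : Config E → Config E → Config E → R)

/-- **THE CRUX OF RECORD FROM (TRI) ON THE DOMAIN WITH `o ≠ b`** — unconditional (on the layers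
below and the coincidence theorem). -/
theorem HCov_all_of_residualCoreNHatCTBRASUD_all (hc : ResidualCoreNHatCTBRASUD_all R) :
    HCov_all R := by
  refine HCov_all_of_residualCoreNHatCTBRASU_all R ?_
  intro V E _ _ _ _ ends o a₁ a₂ a₃ b F τ hτ hcore
  by_cases hob : o = b
  · subst hob
    exact RootBridge.typedCount_nonneg_of_o_eq_b ends _ a₁ a₂ a₃ F (fun _ => false) τ hτ
  · exact hc V E ends o a₁ a₂ a₃ b F τ hτ ⟨hcore, hob⟩

end ClosureDistinctOB

section CoreOBehind

variable {V : Type*} {E : Type*} [DecidableEq V] [Fintype E] [DecidableEq E]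

/-- **The domain of record without the class «`o` behind `a₃`».** -/
structure ResidualCoreNHatCTBRASUDO (ends : E → Sym2 V) (o a₁ a₂ a₃ b : V) (F : Finset E) :
    Prop where
  coreNHatCTBRASUD : ResidualCoreNHatCTBRASUD ends o a₁ a₂ a₃ b F
  not_oBehindA3 : ¬ RootBridge.OBehindA3 ends o a₁ a₂ a₃ F (fun _ => false)

end CoreOBehind

section ClosureOBehind

variable (R : Type*) [Field R] [LinearOrder R] [IsStrictOrderedRing R]

/-- **Row 2′TRI on `ResidualCoreNHatCTBRASUDO`, over every finite graph.** -/
def ResidualCoreNHatCTBRASUDO_all : Prop :=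
  ∀ (V E : Type) [Fintype V] [DecidableEq V] [Fintype E] [DecidableEq E]
    (ends : E → Sym2 V) (o a₁ a₂ a₃ b : V) (F : Finset E) (τ : E → ℕ),
    (∀ e ∈ F, τ e = 1 ∨ τ e = 2) → ResidualCoreNHatCTBRASUDO ends o a₁ a₂ a₃ b F →
      0 ≤ typedCount F (fun _ => false) τ
        (K3 ends o a₁ a₂ a₃ b : Config E → Config E → Config E → R)

/-- **THE CRUX OF RECORD FROM (TRI) ON THE DOMAIN WITHOUT «`o` BEHIND `a₃`»** — unconditional
(on the layers below and the exact-zero theorem). -/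
theorem HCov_all_of_residualCoreNHatCTBRASUDO_all (hc : ResidualCoreNHatCTBRASUDO_all R) :
    HCov_all R := by
  refine HCov_all_of_residualCoreNHatCTBRASUD_all R ?_
  intro V E _ _ _ _ ends o a₁ a₂ a₃ b F τ hτ hcore
  by_cases hob : RootBridge.OBehindA3 ends o a₁ a₂ a₃ F (fun _ => false)
  · exact le_of_eq
      (RootBridge.typedCount_eq_zero_of_oBehindA3 ends o a₁ a₂ a₃ b F (fun _ => false) τ hτ hob).symm
  · exact hc V E ends o a₁ a₂ a₃ b F τ hτ ⟨hcore, hob⟩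

end ClosureOBehind

section Unfold

variable {V : Type*} {E : Type*} [DecidableEq V] [Fintype E] [DecidableEq E]
variable (ends : E → Sym2 V) (o a₁ a₂ a₃ b : V) (F : Finset E)

omit [DecidableEq V] [Fintype E] in
/-- **The domain of record as a flat conjunction**: the residual core (reduced, `≥ 6` typed edges,
the four marks `a₁, a₂, o, b` touched, `a₁ ~ a₂` in `(V, F)`, every typed edge root-reachable, no
same-side root bridge, distinct marks) without hats, without a root cut, without a two-terminal
part, without a root bundle, without the two cut-roots classes, without a one-star of degree
three, NOT mild, with `o ≠ b`, and with `o` not behind `a₃`. -/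
theorem ResidualCoreNHatCTBRASUDO_iff :
    ResidualCoreNHatCTBRASUDO ends o a₁ a₂ a₃ b F ↔
      ResidualCore ends o a₁ a₂ a₃ b F ∧
      ¬ Hats ends o a₁ a₂ a₃ b F ∧
      ¬ HasRootCut ends o a₁ a₂ a₃ b F ∧
      ¬ HasTwoTerminalPart ends o a₁ a₂ a₃ b F ∧
      ¬ HasRootBundle ends o a₁ a₂ a₃ b F ∧
      ¬ RootBridge.HasCutRoots ends o a₁ a₂ a₃ b F ∧
      ¬ RootBridge.HasCutRootsA3 ends o a₁ a₂ a₃ b F ∧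
      ¬ OneStar ends o a₁ a₂ a₃ b F ∧
      ¬ RootBridge.MildInst ends o a₁ a₂ a₃ b F (fun _ => false) ∧
      o ≠ b ∧
      ¬ RootBridge.OBehindA3 ends o a₁ a₂ a₃ F (fun _ => false) := by
  constructor
  · rintro ⟨⟨⟨⟨⟨⟨⟨⟨⟨hcore, hh⟩, hcut⟩, hT, hB⟩, hr⟩, hra⟩, hs⟩, hm⟩, hob⟩, hobh⟩
    exact ⟨hcore, hh, hcut, hT, hB, hr, hra, hs, hm, hob, hobh⟩
  · rintro ⟨hcore, hh, hcut, hT, hB, hr, hra, hs, hm, hob, hobh⟩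
    exact ⟨⟨⟨⟨⟨⟨⟨⟨⟨hcore, hh⟩, hcut⟩, hT, hB⟩, hr⟩, hra⟩, hs⟩, hm⟩, hob⟩, hobh⟩

end Unfold

section ClosureFlat

variable (R : Type*) [Field R] [LinearOrder R] [IsStrictOrderedRing R]

/-- **Row 2′TRI on the flat domain, over every finite graph.** -/
def FlatDomain_all : Prop :=
  ∀ (V E : Type) [Fintype V] [DecidableEq V] [Fintype E] [DecidableEq E]
    (ends : E → Sym2 V) (o a₁ a₂ a₃ b : V) (F : Finset E) (τ : E → ℕ),
    (∀ e ∈ F, τ e = 1 ∨ τ e = 2) →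
    ResidualCore ends o a₁ a₂ a₃ b F →
    ¬ Hats ends o a₁ a₂ a₃ b F →
    ¬ HasRootCut ends o a₁ a₂ a₃ b F →
    ¬ HasTwoTerminalPart ends o a₁ a₂ a₃ b F →
    ¬ HasRootBundle ends o a₁ a₂ a₃ b F →
    ¬ RootBridge.HasCutRoots ends o a₁ a₂ a₃ b F →
    ¬ RootBridge.HasCutRootsA3 ends o a₁ a₂ a₃ b F →
    ¬ OneStar ends o a₁ a₂ a₃ b F →
    ¬ RootBridge.MildInst ends o a₁ a₂ a₃ b F (fun _ => false) →
    o ≠ b →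
    ¬ RootBridge.OBehindA3 ends o a₁ a₂ a₃ F (fun _ => false) →
      0 ≤ typedCount F (fun _ => false) τ
        (K3 ends o a₁ a₂ a₃ b : Config E → Config E → Config E → R)

/-- **THE CRUX OF RECORD FROM (TRI) ON THE FLAT DOMAIN** — the sentence of record in one
statement (on the landed certificate bundle `K5.starCerts_holds`). -/
theorem HCov_all_of_flat_all (hc : FlatDomain_all R) : HCov_all R := by
  refine HCov_all_of_residualCoreNHatCTBRASUDO_all R ?_
  intro V E _ _ _ _ ends o a₁ a₂ a₃ b F τ hτ hcore
  obtain ⟨h0, h1, h2, h3, h4, h5, h6, h7, h8, h9, h10⟩ :=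
    (ResidualCoreNHatCTBRASUDO_iff ends o a₁ a₂ a₃ b F).1 hcore
  exact hc V E ends o a₁ a₂ a₃ b F τ hτ h0 h1 h2 h3 h4 h5 h6 h7 h8 h9 h10

end ClosureFlat

end TypedRed

end CovForm

end Summit.Ventures.PercRepro2
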